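import Summits.AnomalousDissipation.AnomalousDissipation.Theorems.SolenoidalFractalHomogenisationLagrangianStepSidebandResponseExtFrame
import Summits.AnomalousDissipation.AnomalousDissipation.Theorems.SolenoidalFractalHomogenisationLagrangianStepSidebandResponseExtContinuous
import HarnessLib

/-!
# K1L_D `LagrangianRenormalisationStepDesign` (stmt-AnomalousDissipation-27980), registered stub `stub_D1_V0thg` (v28, D28-3 (3)/D28-6/D28-7), port-map layer L4:
# the periodic extension `responseExtθ` of the TWISTED reference response is CONTINUOUS (helper; `--kind proof --supports stmt-AnomalousDissipation-27980 --as helper`)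

Summits-side helper file of route `SolenoidalFractalHomogenisation` (prover seat `ad-k1l-cellLawV-w1` g9; road of record D28-7 = port map §3 L4).  Everything proved; no
definitions, no named facts, no sorry.  The frozen-frame twin of `…SidebandResponseExtContinuous`: `responseExtθ_eq_responseθ_toIocMod`, **`continuous_responseExtθ`**,
`continuousOn_responseExtθ`.  NOT a proof of `stub_D1_V0thg`, of K1L_D, or of anomalous dissipation; rung F-D1.A0 infrastructure.
-/

set_option linter.dupNamespace false

noncomputable section

namespace Summit.AnomalousDissipation.AnomalousDissipation.Theorems.SolenoidalFractalHomogenisation.LagrangianStep.Sideband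

open Set MeasureTheory Complex UnitAddTorus Filter Topology
open scoped InnerProductSpace
open Literature.Analysis Literature.Analysis.FunctionSpaces Literature.Analysis.FunctionSpaces.Torus
open Literature.Analysis.FluidPDE Literature.Analysis.FluidPDE.Torus Literature.Analysis.FluidPDE.LatticeShear
open Summit.AnomalousDissipation.AnomalousDissipation.Theorems.SolenoidalFractalHomogenisation.PermissibleCarrier (period_pos)

variable {k₀ : ℕ}

/-- **At the junctions the two reductions agree through the response**: `responseExt t = response (toIocMod P 0 t)` (the response closes up,
`response P = response 0`). [cite: SandersVerhulstMurdock2007, Lemma 5.2.7 (linear case)] -/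
theorem responseExtθ_eq_responseθ_toIocMod (W₁ : LatticeWord k₀) (𝔸 : Torus.Visc4 (Fin 3)) (G₀ : Matrix (Fin 3) (Fin 3) ℝ) (γ₁ : ℝ) (R : ℕ) (j : Fin k₀)
    (hN : IsPeriodicResponseθ W₁ 𝔸 G₀ γ₁ R j (responseθ W₁ 𝔸 G₀ γ₁ R j)) (t : ℝ) :
    responseExtθ W₁ 𝔸 G₀ γ₁ R j t = responseθ W₁ 𝔸 G₀ γ₁ R j (toIocMod (period_pos W₁) 0 t) := by
  rw [responseExtθ_def]
  by_cases h : (0 : ℝ) ≡ t [PMOD W₁.period]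
  · rw [(AddCommGroup.modEq_iff_toIcoMod_eq_left (period_pos W₁)).1 h, (AddCommGroup.modEq_iff_toIocMod_eq_right (period_pos W₁)).1 h, zero_add]
    exact hN.2.2.symm
  · rw [(AddCommGroup.not_modEq_iff_toIcoMod_eq_toIocMod (period_pos W₁)).1 h]

/-- **The periodic extension of the reference response is continuous.** [cite: SandersVerhulstMurdock2007, Lemma 5.2.7 (linear case)] -/
theorem continuous_responseExtθ (W₁ : LatticeWord k₀) (𝔸 : Torus.Visc4 (Fin 3)) (G₀ : Matrix (Fin 3) (Fin 3) ℝ) (γ₁ : ℝ) (R : ℕ) (j : Fin k₀)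
    (hN : IsPeriodicResponseθ W₁ 𝔸 G₀ γ₁ R j (responseθ W₁ 𝔸 G₀ γ₁ R j)) : Continuous (responseExtθ W₁ 𝔸 G₀ γ₁ R j) := by
  have hP := period_pos W₁
  have hc : ContinuousOn (responseθ W₁ 𝔸 G₀ γ₁ R j) (Icc 0 W₁.period) := hN.1
  rw [continuous_iff_continuousAt]
  intro t
  rw [continuousAt_iff_continuous_left_right]
  constructor
  · -- from the left through `toIocMod`
    have hfun : responseExtθ W₁ 𝔸 G₀ γ₁ R j = fun τ => responseθ W₁ 𝔸 G₀ γ₁ R j (toIocMod hP 0 τ) :=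
      funext (responseExtθ_eq_responseθ_toIocMod W₁ 𝔸 G₀ γ₁ R j hN)
    rw [hfun]
    have hmem : toIocMod hP 0 t ∈ Icc 0 W₁.period := by
      have := toIocMod_mem_Ioc hP 0 t; rw [zero_add] at this; exact Ioc_subset_Icc_self this
    refine ContinuousWithinAt.comp (hc _ hmem) (continuousWithinAt_toIocMod_Iic hP 0 t) ?_
    intro τ _
    have := toIocMod_mem_Ioc hP 0 τ; rw [zero_add] at this; exact Ioc_subset_Icc_self this
  · -- from the right through `toIcoMod`
    have hfun : responseExtθ W₁ 𝔸 G₀ γ₁ R j = fun τ => responseθ W₁ 𝔸 G₀ γ₁ R j (toIcoMod hP 0 τ) := funext fun τ => responseExtθ_def W₁ 𝔸 G₀ γ₁ R j τ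
    rw [hfun]
    have hmem : toIcoMod hP 0 t ∈ Icc 0 W₁.period := Ico_subset_Icc_self (by simpa using toIcoMod_mem_Ico' hP t)
    refine ContinuousWithinAt.comp (hc _ hmem) (continuousWithinAt_toIcoMod_Ici hP 0 t) ?_
    intro τ _
    exact Ico_subset_Icc_self (by simpa using toIcoMod_mem_Ico' hP τ)

/-- Continuity on any set (the form `ContinuousOn` arguments consume). [cite: SandersVerhulstMurdock2007, Lemma 5.2.7 (linear case)] -/
theorem continuousOn_responseExtθ (W₁ : LatticeWord k₀) (𝔸 : Torus.Visc4 (Fin 3)) (G₀ : Matrix (Fin 3) (Fin 3) ℝ) (γ₁ : ℝ) (R : ℕ) (j : Fin k₀)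
    (hN : IsPeriodicResponseθ W₁ 𝔸 G₀ γ₁ R j (responseθ W₁ 𝔸 G₀ γ₁ R j)) (s : Set ℝ) : ContinuousOn (responseExtθ W₁ 𝔸 G₀ γ₁ R j) s :=
  (continuous_responseExtθ W₁ 𝔸 G₀ γ₁ R j hN).continuousOn

end Summit.AnomalousDissipation.AnomalousDissipation.Theorems.SolenoidalFractalHomogenisation.LagrangianStep.Sideband

end
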